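import Summits.BirchSwinnertonDyer.BirchSwinnertonDyer.Theorems.SignedLowerHalvesKobayashiLowerHalfSemistableScope
import Summits.BirchSwinnertonDyer.BirchSwinnertonDyer.Theorems.SignedLowerHalvesKobayashiLowerHalfSemistableScopeThree
import Literature.NumberTheory.QuadraticFields.ThreeIndivisibleClassNumberLocalConditions
import Literature.NumberTheory.EllipticCurves.SemistablePeuRamifieRamifiedPrime
import Literature.NumberTheory.EllipticCurves.Rank1Residual.X11Three
import HarnessLib

/-!
# Route `SignedLowerHalves`, crux `KobayashiLowerHalfSemistable` (item stmt-BirchSwinnertonDyer-19000): the class-wide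
# scope witness REDUCED to a pure class-number statement — `BSTWScope.HasWitness W p` ⟸ (a (ram) prime) ∧ CL(p) —
# and, at `p ≤ 7`, to CL(p) alone (cell `bsd-ssimc`, seat `bsd-ssimc-k3-c2` gen 2; a `--supports … --as helper` file,
# closes nothing)

PARTITION (cell bsd-ssimc): X6 ∧ r = 0 (A6) × 13 (+10~) × p ∈ {3,5} + X6 r1 + D1/D2 — types-the-object-of (it locates the
ONE non-PRE, non-published hypothesis of the `p ≥ 5` half of crux 2 as a statement about class numbers of imaginary
quadratic fields); closes NONE. THEOREMS ONLY. HONEST FRAMING: nothing here is a theorem about Kobayashi's conjecture or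
about BSTW; BSD is not proved by any of this; the crux stays OPEN; nothing is booked.

## What this file says

Gen 0 closed the registered stub `stub_five_le` modulo the cell-verified-scope binder AND a class-wide witness hypothesis
`hwit : ∀ W p, 5 ≤ p → ClassX6 W p → BSTWScope.HasWitness W p` («NOT free class-wide; decidable per class»), and gen 2
(`…SemistableScopeThree.lean`) DISCHARGED the `p = 3` witness from print (Ribet–Diamond + Bhargava–Varma). Here the
witness is reduced, at EVERY prime, to its arithmetic core:
* CL(p) — the displayed HYPOTHESIS (spelled inline in each signature; deliberately NOT a definition or a fact): «for all
  disjoint finite sets `S`, `T` of primes there is an imaginary quadratic field with every prime of `S` split, every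
  prime of `T` inert (all unramified) and class number prime to `p`». At `p = 3` it IS (the body of) the tree's named fact
  `Literature.NumberTheory.QuadraticFields.bhargavaVarma2016_exists_imaginaryQuadratic_split_inert_three_not_dvd_classNumber`
  (Bhargava–Varma 2016 Cor. 4 (a)); at a prime `p ≥ 5` it is OPEN IN PRINT (Cohen–Lenstra-type existence with local
  conditions at `2` and at `p`: Wiles, JLMS 92 (2015) Thm 0.0.1 / Beckwith 2017 — odd primes only and no split prime
  `≡ −1 (mod p)`; Beckwith–Raum–Richter arXiv:2305.19272 Thm 1 — split conditions only; Bruinier 1999 — primes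
  `≢ 0, ±1 (mod p)` only; Kohnen–Ono 1999 — no local conditions). It is a HYPOTHESIS here, not a fact (cell rule r3: no
  `Prop` smuggled — it is displayed and named as THE gap; MEMO-2 §3).
* `BSTWScope_hasWitness_of_existsAuxField_of_ram` — for any `W`, `p`: CL(p) and a (ram) prime (`Rank1Residual.Ram W p`) give
  `BSTWScope.HasWitness W p` (S = ({p, 2} ∪ {ℓ ∣ Δ_min}) ∖ {q} split, T = {q} inert; the gen-2 proof at 3, verbatim in `p`).
* `BSTWScope_hasWitness_of_existsAuxField_of_le_seven` — at an odd `p ≤ 7` the (ram) prime is FREE for semistable `E` with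
  good supersingular reduction at `p` (`E[p]` irreducible ⇒ tree theorem `ram_of_semistable_of_irr_of_le_seven`, modulo
  modularity + Diamond 1995 / Ribet 1990), so `HasWitness W p ⟸ CL(p)` alone; in particular the class-wide hypothesis
  `hwit` of gen 0's `stub_five_le_of_thm13_scoped_OPEN` restricted to `p ∈ {5, 7}` is EXACTLY CL(5) ∧ CL(7).
* (coherence) at `p = 3`, CL(3) is the Bhargava–Varma fact by name and the reduction specialises to gen 2's landed
  `BSTWScope_hasWitness_three_of_semistable` (not restated here — dedup).

What this is NOT: not a discharge at `p ≥ 5`; nothing is booked. APPENDIX (same session): the (ram) prime IS free at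
every odd GOOD prime by the tree's `SkinnerUrban2014.ram_of_semistable_of_irr` (weight-2 level-lowering; found after the
first landing), so `BSTWScope_hasWitness_of_existsAuxField_of_goodSS`, `stub_five_le_of_thm13_scoped_OPEN_of_classNumberHypothesis`
and `KobayashiLowerHalfSemistable_of_tiers_of_classNumberHypothesis` supersede the `p ≤ 7` / `hram` forms: on X6 the (α)
rider is EXACTLY CL(p) at every odd `p`, and the crux BY NAME reads modulo {two PRE tiers, published facts, CL(p) for p ≥ 5}.

References: [BurungaleSkinnerTianWan2024] II §2.3 (PRE; shape of S1/S2 only); [BhargavaVarma2016] Cor. 4 (a);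
[Ribet1990] Thm 1.1; [Diamond1995RefinedSerre] Thm 1.1; [Wiles2015ClassGroups] Thm 0.0.1 (for the OPEN status at p ≥ 5);
cell records MEMO-2 (bb79592c9ab3fdb0) §3, REPORT-k3c2-1 M3.
-/

set_option autoImplicit false
set_option linter.dupNamespace false

noncomputable section

open scoped Classical

open WeierstrassCurve NumberField Literature.NumberTheory.EllipticCurves
  Literature.NumberTheory.EllipticCurves.ModularForms
  Literature.NumberTheory.EllipticCurves.Rank1Residual
  Literature.NumberTheory.EllipticCurves.Rank1Residual.Typed
  Literature.NumberTheory.QuadraticFields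
  Summit.BirchSwinnertonDyer.Rank1Residual.Supersingular

namespace Summit.BirchSwinnertonDyer.BirchSwinnertonDyer.Theorems

/-- **The scope witness from CL(p) and a (ram) prime, at ANY prime `p`.** Given CL(p) (`hCL`) and a multiplicative
prime `q ≠ p` with `p ∤ ord_q(Δ_min)` (`hram : Rank1Residual.Ram W p`, = S1), apply CL(p) with
`S = ({p, 2} ∪ {ℓ ∣ Δ_min}) ∖ {q}` (split) and `T = {q}` (inert): the field is imaginary quadratic, `p` split, `q` inert
and unramified, every other bad prime split and unramified, `2` split (or `2 = q` inert, then `2` is bad and G3 is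
vacuous), so `(d_L, 2N) = 1` — this is S2 + G3 — and `p ∤ h_L` is (α). Hence `BSTWScope.HasWitness W p`. The gen-2 proof
at `p = 3`, verbatim in `p`. No hypothesis on `W` beyond the (ram) prime. Closes nothing.
[cite: BhargavaVarma2016, Cor. 4 (a) (p. 237) (shape of CL(p) only)] [cite: SkinnerUrban2014, Thm. 2 (p. 3), second bullet (shape of (ram) only)] -/
theorem BSTWScope_hasWitness_of_existsAuxField_of_ram (W : WeierstrassCurve ℚ) [W.IsElliptic] [W.IsGloballyMinimal]
    (p : ℕ) [Fact p.Prime]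
    (hCL : (∀ (S T : Finset ℕ), (∀ p' ∈ S, p'.Prime) → (∀ q ∈ T, q.Prime) → Disjoint S T →
        ∃ (L : Type) (_ : Field L) (_ : NumberField L),
          Module.finrank ℚ L = 2 ∧ NumberField.discr L < 0 ∧
          (∀ p' ∈ S, ¬ (p' : ℤ) ∣ NumberField.discr L ∧
            ((Ideal.span {(p' : ℤ)}).primesOver (𝓞 L)).ncard = 2) ∧
          (∀ q ∈ T, ¬ (q : ℤ) ∣ NumberField.discr L ∧
            ((Ideal.span {(q : ℤ)}).primesOver (𝓞 L)).ncard = 1) ∧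
          ¬ p ∣ NumberField.classNumber L))
    (hram : Ram W p) : BSTWScope.HasWitness W p := by
  obtain ⟨q, hqF, hqp, hmult, hord⟩ := hram
  have hqP : q.Prime := hqF.out
  have hpP : p.Prime := Fact.out
  set B : Finset ℕ := (minimalDiscriminantInt W).natAbs.primeFactors with hB
  set S : Finset ℕ := (insert p (insert 2 B)).erase q with hS
  have hSprime : ∀ p' ∈ S, p'.Prime := by
    intro p' hp'
    rcases Finset.mem_insert.mp (Finset.mem_of_mem_erase hp') with rfl | hp''
    · exact hpP
    rcases Finset.mem_insert.mp hp'' with rfl | hp'''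
    · norm_num
    exact Nat.prime_of_mem_primeFactors hp'''
  have hdisj : Disjoint S {q} := by
    rw [Finset.disjoint_singleton_right]
    exact Finset.notMem_erase q _
  obtain ⟨L, _instF, _instN, h2, hneg, hSsplit, hTinert, hh⟩ :=
    hCL S {q} hSprime (by simpa using hqP) hdisj
  have hqT : q ∈ ({q} : Finset ℕ) := Finset.mem_singleton_self q
  have hbadB : ∀ ℓ : ℕ, (hℓ : ℓ.Prime) →
      (haveI : Fact ℓ.Prime := ⟨hℓ⟩; ¬ W.HasGoodReductionAtPrime ℓ) → ℓ ∈ B := by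
    intro ℓ hℓ hbad
    haveI : Fact ℓ.Prime := ⟨hℓ⟩
    have hd := natCast_dvd_minimalDiscriminantInt_of_not_hasGoodReductionAtPrime (W := W) ℓ hbad
    rw [hB, Nat.mem_primeFactors]
    refine ⟨hℓ, ?_, Int.natAbs_ne_zero.mpr (minimalDiscriminantInt_ne_zero W)⟩
    have := Int.natAbs_dvd_natAbs.mpr hd
    simpa using this
  have hmemS : ∀ ℓ : ℕ, ℓ ≠ q → (ℓ = p ∨ ℓ = 2 ∨ ℓ ∈ B) → ℓ ∈ S := by
    intro ℓ hℓq h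
    rw [hS, Finset.mem_erase]
    refine ⟨hℓq, ?_⟩
    rcases h with rfl | rfl | h
    · exact Finset.mem_insert_self _ _
    · exact Finset.mem_insert_of_mem (Finset.mem_insert_self _ _)
    · exact Finset.mem_insert_of_mem (Finset.mem_insert_of_mem h)
  refine ⟨q, hqF, L, _instF, _instN, ⟨hqp, hmult, hord⟩, ⟨?_, ?_, ?_, ?_, ?_, ?_, ?_⟩, hh⟩
  · exact (isImaginaryQuadratic_iff_discr_neg).mpr ⟨h2, hneg⟩
  · exact (hSsplit p (hmemS p (Ne.symm hqp) (Or.inl rfl))).2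
  · exact (hTinert q hqT).2
  · intro ℓ hℓ hℓq hbad
    exact (hSsplit ℓ (hmemS ℓ hℓq (Or.inr (Or.inr (hbadB ℓ hℓ hbad))))).2
  · by_cases h2q : (2 : ℕ) = q
    · have := (hTinert q hqT).1
      rw [← h2q] at this
      exact_mod_cast this
    · exact_mod_cast (hSsplit 2 (hmemS 2 h2q (Or.inr (Or.inl rfl)))).1
  · intro ℓ hℓ hbad
    by_cases hℓq : ℓ = q
    · subst hℓq; exact (hTinert ℓ hqT).1
    · exact (hSsplit ℓ (hmemS ℓ hℓq (Or.inr (Or.inr (hbadB ℓ hℓ hbad))))).1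
  · intro hgood2
    by_cases h2q : (2 : ℕ) = q
    · subst h2q
      exact absurd hgood2 (not_hasGoodReductionAtPrime_of_hasMultiplicativeReductionAtPrime 2 hmult)
    · exact_mod_cast (hSsplit 2 (hmemS 2 h2q (Or.inr (Or.inl rfl)))).2

/-- **At an odd prime `p ≤ 7`: `HasWitness W p ⟸ CL(p)` for every semistable `E` with good supersingular reduction at
`p`** — the (ram) prime is free: `E[p]` is irreducible (supersingular, `hasIrreducibleModPGaloisRep_of_dvd_frobeniusTrace`)
so Ribet–Diamond level-lowering (tree theorem `ram_of_semistable_of_irr_of_le_seven`, modulo modularity `hmod` and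
`hLL` = Diamond 1995 Thm 1.1 / Ribet 1990 Thm 1.1) supplies it. Consequently the class-wide hypothesis `hwit` of gen 0's
`stub_five_le_of_thm13_scoped_OPEN`, restricted to `p ∈ {5, 7}`, is EXACTLY CL(5) ∧ CL(7) — a statement about class
numbers of imaginary quadratic fields with prescribed local behaviour, OPEN in print. CONDITIONAL on `hCL`; closes nothing.
[cite: Ribet1990, Thm. 1.1] [cite: Diamond1995RefinedSerre, Thm. 1.1] [cite: BhargavaVarma2016, Cor. 4 (a) (p. 237) (shape of CL(p) only)] -/
theorem BSTWScope_hasWitness_of_existsAuxField_of_le_seven (hmod : exists_isNewformOf)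
    (hLL : Literature.NumberTheory.Automorphic.diamond1995_refinedSerre)
    (W : WeierstrassCurve ℚ) [W.IsElliptic] [W.IsGloballyMinimal] (p : ℕ) [Fact p.Prime]
    (hp2 : p ≠ 2) (hp7 : p ≤ 7)
    (hCL : (∀ (S T : Finset ℕ), (∀ p' ∈ S, p'.Prime) → (∀ q ∈ T, q.Prime) → Disjoint S T →
        ∃ (L : Type) (_ : Field L) (_ : NumberField L),
          Module.finrank ℚ L = 2 ∧ NumberField.discr L < 0 ∧
          (∀ p' ∈ S, ¬ (p' : ℤ) ∣ NumberField.discr L ∧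
            ((Ideal.span {(p' : ℤ)}).primesOver (𝓞 L)).ncard = 2) ∧
          (∀ q ∈ T, ¬ (q : ℤ) ∣ NumberField.discr L ∧
            ((Ideal.span {(q : ℤ)}).primesOver (𝓞 L)).ncard = 1) ∧
          ¬ p ∣ NumberField.classNumber L))
    (hsst : Semistable W) (hss : GoodSS W p) : BSTWScope.HasWitness W p := by
  have hirr : Irr W p :=
    hasIrreducibleModPGaloisRep_of_dvd_frobeniusTrace W p hp2
      (W.not_dvd_minimalDiscriminantInt_of_hasGoodReductionAtPrime' p hss.1) hss.2
  exact BSTWScope_hasWitness_of_existsAuxField_of_ram W p hCL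
    (ram_of_semistable_of_irr_of_le_seven hmod hLL W p hp2 hp7 hsst hirr)

/-- **`stub_five_le` (verbatim header) restricted in cost: MODULO the cell-verified-scope binder, CL(p) at every `p ≥ 5`,
and a (ram) prime at `p ≥ 11`.** Compared with gen 0's `stub_five_le_of_thm13_scoped_OPEN` (binder + `hwit`), the
class-wide witness is replaced by (i) `hCL : ∀ p ≥ 5, CL(p)` — the class-number statement, OPEN in print — and (ii)
`hram : ∀ W p, 11 ≤ p → ClassX6 W p → Ram W p` — Ribet's weight-2 level-lowering consequence, in print for every
`p ≥ 3` but typed in the tree only for `p ≤ 7` (`ram_of_semistable_of_irr_of_le_seven`), hence displayed. So the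
`p ≥ 5` half of crux 2 costs: ONE PRE binder + CL(p) + (for p ≥ 11) a typing of Ribet's theorem. CONDITIONAL; closes
nothing. [claim: BurungaleSkinnerTianWan2024, status: under-review] [cite: Ribet1990, Thm. 1.1]
[cite: Kobayashi2003, Conjecture (Main Conjecture) (p. 2)] -/
theorem stub_five_le_of_thm13_scoped_OPEN_of_existsAuxField
    (hBSTW : BurungaleSkinnerTianWan2024_thm13_scoped_OPEN) (hmod : exists_isNewformOf)
    (hLL : Literature.NumberTheory.Automorphic.diamond1995_refinedSerre)
    (hCL : ∀ p : ℕ, 5 ≤ p → (∀ (S T : Finset ℕ), (∀ p' ∈ S, p'.Prime) → (∀ q ∈ T, q.Prime) → Disjoint S T →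
          ∃ (L : Type) (_ : Field L) (_ : NumberField L),
            Module.finrank ℚ L = 2 ∧ NumberField.discr L < 0 ∧
            (∀ p' ∈ S, ¬ (p' : ℤ) ∣ NumberField.discr L ∧
              ((Ideal.span {(p' : ℤ)}).primesOver (𝓞 L)).ncard = 2) ∧
            (∀ q ∈ T, ¬ (q : ℤ) ∣ NumberField.discr L ∧
              ((Ideal.span {(q : ℤ)}).primesOver (𝓞 L)).ncard = 1) ∧
            ¬ p ∣ NumberField.classNumber L))
    (hram : ∀ (W : WeierstrassCurve ℚ) [W.IsElliptic] [W.IsGloballyMinimal] (p : ℕ) [Fact p.Prime],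
      11 ≤ p → ClassX6 W p → Ram W p) :
    ∀ (W : WeierstrassCurve ℚ) [W.IsElliptic] [W.IsGloballyMinimal] (p : ℕ) [Fact p.Prime],
      p ≠ 2 → Literature.NumberTheory.EllipticCurves.Rank1Residual.ClassX6 W p → 5 ≤ p →
      ∃ ε : ℤˣ, Summit.BirchSwinnertonDyer.Rank1Residual.Supersingular.KobayashiLowerDivisibility W p ε := by
  refine stub_five_le_of_thm13_scoped_OPEN hBSTW ?_
  intro W _ _ p _ h5 hX
  by_cases h7 : p ≤ 7
  · exact BSTWScope_hasWitness_of_existsAuxField_of_le_seven hmod hLL W p (by omega) h7 (hCL p h5) hX.2.1 hX.1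
  · have hpP : p.Prime := Fact.out
    have h11 : 11 ≤ p := by
      by_contra h
      interval_cases p <;> exact absurd hpP (by decide)
    exact BSTWScope_hasWitness_of_existsAuxField_of_ram W p (hCL p h5) (hram W p h11 hX)

/-! ### Appendix (same seat, same session): the (ram) prime is free at EVERY odd good prime -/

/-- **At ANY odd prime `p`: `HasWitness W p ⟸ CL(p)` for every semistable `E` with good supersingular reduction at `p`.**
The (ram) prime is free in the GOOD-reduction case at every odd `p` — the tree's
`SkinnerUrban2014.ram_of_semistable_of_irr` (Ribet's weight-2 level-lowering to level one: `E[p]` finite flat at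
`p ∤ N`, so no weight climbs; modulo modularity `hmod` and `hLL` = Diamond 1995 Thm 1.1 / Ribet 1990 Thm 1.1), with
`E[p]` irreducible from supersingularity. This SUPERSEDES the `p ≤ 7` restriction of
`BSTWScope_hasWitness_of_existsAuxField_of_le_seven` above (which used the any-reduction lemma). So on class X6 the
(α) rider is EXACTLY CL(p) at every odd `p`. CONDITIONAL on `hCL`; closes nothing.
[cite: Ribet1990, Thm. 1.1] [cite: Diamond1995RefinedSerre, Thm. 1.1] [cite: SkinnerUrban2014, remark before Cor. 3.6.10 (p. 45)]
[cite: BhargavaVarma2016, Cor. 4 (a) (p. 237) (shape of CL(p) only)] -/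
theorem BSTWScope_hasWitness_of_existsAuxField_of_goodSS (hmod : exists_isNewformOf)
    (hLL : Literature.NumberTheory.Automorphic.diamond1995_refinedSerre)
    (W : WeierstrassCurve ℚ) [W.IsElliptic] [W.IsGloballyMinimal] (p : ℕ) [Fact p.Prime] (hp2 : p ≠ 2)
    (hCL : (∀ (S T : Finset ℕ), (∀ p' ∈ S, p'.Prime) → (∀ q ∈ T, q.Prime) → Disjoint S T →
        ∃ (L : Type) (_ : Field L) (_ : NumberField L),
          Module.finrank ℚ L = 2 ∧ NumberField.discr L < 0 ∧
          (∀ p' ∈ S, ¬ (p' : ℤ) ∣ NumberField.discr L ∧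
            ((Ideal.span {(p' : ℤ)}).primesOver (𝓞 L)).ncard = 2) ∧
          (∀ q ∈ T, ¬ (q : ℤ) ∣ NumberField.discr L ∧
            ((Ideal.span {(q : ℤ)}).primesOver (𝓞 L)).ncard = 1) ∧
          ¬ p ∣ NumberField.classNumber L))
    (hsst : Semistable W) (hss : GoodSS W p) : BSTWScope.HasWitness W p := by
  have hirr : Irr W p :=
    hasIrreducibleModPGaloisRep_of_dvd_frobeniusTrace W p hp2
      (W.not_dvd_minimalDiscriminantInt_of_hasGoodReductionAtPrime' p hss.1) hss.2
  exact BSTWScope_hasWitness_of_existsAuxField_of_ram W p hCL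
    (Literature.NumberTheory.EllipticCurves.SkinnerUrban2014.ram_of_semistable_of_irr hmod hLL W p hp2 hss.1
      hsst hirr)

/-- **`stub_five_le` (verbatim header) MODULO the cell-verified-scope binder, two PUBLISHED facts, and CL(p) at every
`p ≥ 5` — NO (ram) hypothesis, NO per-class hypothesis.** The class-wide witness `hwit` of gen 0's
`stub_five_le_of_thm13_scoped_OPEN` is EXACTLY `∀ p ≥ 5, CL(p)` (Cohen–Lenstra-type existence for imaginary quadratic
fields with prescribed unramified splitting at finitely many primes, incl. `2` and `p`, and `p ∤ h_L` — OPEN in print at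
every `p ≥ 5`, MEMO-2 §3), granted modularity and Diamond/Ribet level-lowering by name. CONDITIONAL; closes nothing.
[claim: BurungaleSkinnerTianWan2024, status: under-review] [cite: Ribet1990, Thm. 1.1] [cite: Diamond1995RefinedSerre, Thm. 1.1]
[cite: Kobayashi2003, Conjecture (Main Conjecture) (p. 2)] -/
theorem stub_five_le_of_thm13_scoped_OPEN_of_classNumberHypothesis
    (hBSTW : BurungaleSkinnerTianWan2024_thm13_scoped_OPEN) (hmod : exists_isNewformOf)
    (hLL : Literature.NumberTheory.Automorphic.diamond1995_refinedSerre)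
    (hCL : ∀ p : ℕ, 5 ≤ p → (∀ (S T : Finset ℕ), (∀ p' ∈ S, p'.Prime) → (∀ q ∈ T, q.Prime) → Disjoint S T →
          ∃ (L : Type) (_ : Field L) (_ : NumberField L),
            Module.finrank ℚ L = 2 ∧ NumberField.discr L < 0 ∧
            (∀ p' ∈ S, ¬ (p' : ℤ) ∣ NumberField.discr L ∧
              ((Ideal.span {(p' : ℤ)}).primesOver (𝓞 L)).ncard = 2) ∧
            (∀ q ∈ T, ¬ (q : ℤ) ∣ NumberField.discr L ∧
              ((Ideal.span {(q : ℤ)}).primesOver (𝓞 L)).ncard = 1) ∧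
            ¬ p ∣ NumberField.classNumber L)) :
    ∀ (W : WeierstrassCurve ℚ) [W.IsElliptic] [W.IsGloballyMinimal] (p : ℕ) [Fact p.Prime],
      p ≠ 2 → Literature.NumberTheory.EllipticCurves.Rank1Residual.ClassX6 W p → 5 ≤ p →
      ∃ ε : ℤˣ, Summit.BirchSwinnertonDyer.Rank1Residual.Supersingular.KobayashiLowerDivisibility W p ε :=
  stub_five_le_of_thm13_scoped_OPEN hBSTW fun W _ _ p _ h5 hX =>
    BSTWScope_hasWitness_of_existsAuxField_of_goodSS hmod hLL W p (by omega) (hCL p h5) hX.2.1 hX.1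

/-- **The crux BY NAME, SHARPEST FORM of record: two PRE tier binders + PUBLISHED facts + the class-number
statements CL(p), `p ≥ 5`.** Every hypothesis is either (i) an OPEN binder transcribing the PRE engine in the regime the
cell verified (`…thm13_scoped_OPEN`: p ≥ 5, REPORT-bstw-6; `…thm13_scopedAtThree_OPEN`: p = 3, REPORT-bstw-7, resting on
(3-ii)♭), or (ii) a PUBLISHED named fact (modularity `hmod`; Diamond 1995 / Ribet 1990 `hLL`; Bhargava–Varma 2016 Cor. 4 (a)
`hBV`), or (iii) the displayed arithmetic statement CL(p) for `p ≥ 5` (OPEN in print; TRUE per class for every A6 / D2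
cell of the window by the kernel / two-engine witness tables). Nothing else. CONDITIONAL (`conditional-result`); the item
stays OPEN. [claim: BurungaleSkinnerTianWan2024, status: under-review] [cite: BhargavaVarma2016, Cor. 4 (a) (p. 237)]
[cite: Ribet1990, Thm. 1.1] [cite: Kobayashi2003, Conjecture (Main Conjecture) (p. 2)] -/
theorem KobayashiLowerHalfSemistable_of_tiers_of_classNumberHypothesis
    (hBSTW5 : BurungaleSkinnerTianWan2024_thm13_scoped_OPEN)
    (hBSTW3 : BurungaleSkinnerTianWan2024_thm13_scopedAtThree_OPEN) (hmod : exists_isNewformOf)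
    (hLL : Literature.NumberTheory.Automorphic.diamond1995_refinedSerre)
    (hBV : bhargavaVarma2016_exists_imaginaryQuadratic_split_inert_three_not_dvd_classNumber)
    (hCL : ∀ p : ℕ, 5 ≤ p → (∀ (S T : Finset ℕ), (∀ p' ∈ S, p'.Prime) → (∀ q ∈ T, q.Prime) → Disjoint S T →
          ∃ (L : Type) (_ : Field L) (_ : NumberField L),
            Module.finrank ℚ L = 2 ∧ NumberField.discr L < 0 ∧
            (∀ p' ∈ S, ¬ (p' : ℤ) ∣ NumberField.discr L ∧
              ((Ideal.span {(p' : ℤ)}).primesOver (𝓞 L)).ncard = 2) ∧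
            (∀ q ∈ T, ¬ (q : ℤ) ∣ NumberField.discr L ∧
              ((Ideal.span {(q : ℤ)}).primesOver (𝓞 L)).ncard = 1) ∧
            ¬ p ∣ NumberField.classNumber L)) :
    Summit.BirchSwinnertonDyer.BirchSwinnertonDyer.Theses.SignedLowerHalves.KobayashiLowerHalfSemistable :=
  KobayashiLowerHalfSemistable_of_tiers_of_published hBSTW5 hBSTW3 hmod hLL hBV fun W _ _ p _ h5 hX =>
    BSTWScope_hasWitness_of_existsAuxField_of_goodSS hmod hLL W p (by omega) (hCL p h5) hX.2.1 hX.1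

end Summit.BirchSwinnertonDyer.BirchSwinnertonDyer.Theorems

end
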